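import Literature.Computability.Complexity.GateEliminationCase6Core
import Literature.Computability.Complexity.GateEliminationCase82Leaves
import Literature.Computability.Complexity.GateEliminationCase81Dispatch

/-!
# Gate elimination: Case 8 of Li–Yang's Theorem 4.1, dispatched to Case 8.2

Case 8 of §4.1 (ECCC TR21-023, p. 30): "Without loss of generality, we assume that `Q = I₂` is a
gate, while `P = I₁` can be either a gate or a variable. If `P` is a gate, we further assume that
the out-degree of `P` is not larger than `Q`. By the minimality of `G`, `Q` computes some affine
function." Case 8.1: "`Q` computes an affine function depending on some unprotected variable
`x`" — the tree's `Semicircuit.case8_1`; "For the rest of Case 8, we assume that for any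
topologically minimal ∧-type gate `G` fed by some `P` and an ⊕-type gate `Q` satisfying the
assumption at the start of Case 8 …, `Q` computes an affine function depending only on protected
variables. Moreover, if `I₁` is an ⊕-type gate with out-degree equal to `Q`, it also computes an
affine function depending only on protected variables." Case 8.2: "`Q` computes an affine
function depending on a set of protected variables, say `I`".

PROVED here: `LiYang2022_cases6to8_of_case8_2` — the named fact `LiYang2022_cases6to8` follows
from the claim of Case 8.2 taken as an explicit hypothesis in the precise form produced by this
dispatch (the role assignment by out-degrees and the two applications of Case 8.1), and from
Case 6, which in the tree is the dichotomy `Semicircuit.protSubst_dichotomy` used inside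
Case 8.2, not a separate obligation. Also `Semicircuit.noAndTwoVars_iff`.

## References

* J. Li, T. Yang, *3.1n − o(n) circuit lower bounds for explicit functions*, STOC 2022;
  ECCC TR21-023, §4.1 (Case 8, Case 8.1, Case 8.2).
-/

namespace Literature.Computability.Complexity

open Finset

namespace Semicircuit

variable {n : ℕ} {C : Semicircuit n} {f : (Fin n → ZMod 2) → Bool} {R : RdqSource n} {d : ℕ} {αφ αI αQ : ℝ}

/-- **The hypotheses of Case 8.2 of the proof of Thm. 4.1** at the ∧-type gate `G` reading the
gate `Q` of the xor-part at position `aQ` (after the role assignment of Case 8 and after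
Case 8.1): every variable on which `Q` depends is protected; the other wire of `G` is a variable,
or a gate `Q'` of the xor-part of out-degree at most that of `Q` which, in case of equality, also
depends on protected variables only. [cite: LiYang2022, §4.1 (Case 8, Case 8.2)] -/
def Case82Hyp (C : Semicircuit n) (hF : C.Fair) (R : RdqSource n) (G Q : Fin C.m) (aQ : Fin 2) : Prop :=
  IsAndOp (C.op G) ∧ C.arg G aQ = .gate Q ∧ Q ∈ C.xorPart ∧ (∀ x, C.DependsOn hF Q x → R.Protected x) ∧
    ((∃ t, C.arg G aQ.rev = .var t) ∨
      ∃ Q', C.arg G aQ.rev = .gate Q' ∧ Q' ∈ C.xorPart ∧ C.fanout (.gate Q') ≤ C.fanout (.gate Q) ∧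
        (C.fanout (.gate Q') = C.fanout (.gate Q) → ∀ x, C.DependsOn hF Q' x → R.Protected x))

end Semicircuit

open Semicircuit

/-- **Case 8 of the proof of Thm. 4.1, dispatched** (the role assignment "we assume that
`Q = I₂` is a gate … if `P` is a gate, we further assume that the out-degree of `P` is not larger
than `Q`", Case 8.1 via `case8_1` — applied to `Q`, and to `P` when it is a gate of the same
out-degree —, and "for the rest of Case 8 … `Q` computes an affine function depending only on
protected variables. Moreover, if `I₁` is an ⊕-type gate with out-degree equal to `Q`, it also
computes an affine function depending only on protected variables"): the named fact
`LiYang2022_cases6to8` follows from the claim of Case 8.2 in the form `Semicircuit.Case82Hyp`.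
[cite: LiYang2022, §4.1 (Case 8, Case 8.1, Case 8.2)] -/
theorem LiYang2022_cases6to8_of_case8_2
    (h82 : ∀ (αφ αI αQ : ℝ), 0 < αφ → αφ < 1 / 2 → 0 < αI → 0 < αQ →
      ∀ (n d : ℕ) (f : (Fin n → ZMod 2) → Bool), IsAffineDisperser f d →
      ∀ (C : Semicircuit n) (R : RdqSource n) (hF : C.Fair), C.ComputesRestr f R → 2 * d + 2 < R.dim → C.Standing R →
      C.NoAndTwoVars → ∀ (G Q : Fin C.m) (aQ : Fin 2), C.Case82Hyp hF R G Q aQ → G ∉ C.xorPart →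
      (∀ (a : Fin 2) (k : Fin C.m), C.arg G a = .gate k → k ∈ C.xorPart) → ¬ C.Case7Config G →
      C.StepGoal f R αφ αI αQ) :
    LiYang2022_cases6to8 := by
  intro αφ αI αQ hφ0 hφ hI hQ n d f hf C R hF hC hd hS hT h2v G hand hGK hGin h7
  classical
  have h2 : C.NoAndTwoVars := h2v
  have hN := hS.normalized.1
  -- the shape of the wires of `G`: not constants, not two variables; gates are in the xor-part
  have hshape : ∀ a, (∃ t, C.arg G a = .var t) ∨ ∃ Q, C.arg G a = .gate Q ∧ Q ∈ C.xorPart := by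
    intro a
    cases h : C.arg G a with
    | const b => exact absurd h (hN.arg_ne_const G a b)
    | var t => exact Or.inl ⟨t, rfl⟩
    | gate Q => exact Or.inr ⟨Q, rfl, hGin a Q h⟩
  -- Case 8.1 at a position `aQ` holding a gate `Q`, with the printed side condition on the other wire
  have h81 : ∀ (aQ : Fin 2) (Q : Fin C.m), C.arg G aQ = .gate Q → Q ∈ C.xorPart →
      (2 ≤ C.fanout (.gate Q) ∨ (∃ t, C.arg G aQ.rev = .var t) ∨
        ∃ Pg, C.arg G aQ.rev = .gate Pg ∧ Pg ∈ C.xorPart ∧ C.fanout (.gate Pg) = 1) →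
      (∃ x, C.DependsOn hF Q x ∧ ¬ R.Protected x) → C.StepGoal f R αφ αI αQ := by
    intro aQ Q hGQ hQK hside ⟨x, hdep, hxp⟩
    exact stepGoal_of_stepBranch2
      (case8_1 hf hd hF hC C.isPacking_empty hφ0.le (by linarith) hI.le αQ hS hand hGQ hQK hdep hxp hside)
  have hcall : ∀ (aQ : Fin 2) (Q : Fin C.m), C.Case82Hyp hF R G Q aQ → C.StepGoal f R αφ αI αQ :=
    fun aQ Q h => h82 αφ αI αQ hφ0 hφ hI hQ n d f hf C R hF hC hd hS h2 G Q aQ h hGK hGin h7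
  -- choose `Q`: a gate wire of maximal out-degree
  rcases hshape 0 with ⟨t0, ht0⟩ | ⟨Q0, hQ0, hQ0K⟩ <;> rcases hshape 1 with ⟨t1, ht1⟩ | ⟨Q1, hQ1, hQ1K⟩
  · exact (h2 G 0 t0 t1 hand ht0 ht1).elim
  · -- `Q = Q1` at position `1`, the other wire is the variable `t0`
    have hrev : C.arg G (1 : Fin 2).rev = .var t0 := ht0
    by_cases hdepQ : ∃ x, C.DependsOn hF Q1 x ∧ ¬ R.Protected x
    · exact h81 1 Q1 hQ1 hQ1K (Or.inr (Or.inl ⟨t0, hrev⟩)) hdepQ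
    · push Not at hdepQ
      exact hcall 1 Q1 ⟨hand, hQ1, hQ1K, hdepQ, Or.inl ⟨t0, hrev⟩⟩
  · -- `Q = Q0` at position `0`, the other wire is the variable `t1`
    have hrev : C.arg G (0 : Fin 2).rev = .var t1 := ht1
    by_cases hdepQ : ∃ x, C.DependsOn hF Q0 x ∧ ¬ R.Protected x
    · exact h81 0 Q0 hQ0 hQ0K (Or.inr (Or.inl ⟨t1, hrev⟩)) hdepQ
    · push Not at hdepQ
      exact hcall 0 Q0 ⟨hand, hQ0, hQ0K, hdepQ, Or.inl ⟨t1, hrev⟩⟩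
  · -- two gates: `Q` is the one of larger out-degree
    have hrev0 : C.arg G (0 : Fin 2).rev = .gate Q1 := hQ1
    have hrev1 : C.arg G (1 : Fin 2).rev = .gate Q0 := hQ0
    have h1Q0 : 1 ≤ C.fanout (.gate Q0) := one_le_fanout_of_arg_eq hQ0
    have h1Q1 : 1 ≤ C.fanout (.gate Q1) := one_le_fanout_of_arg_eq hQ1
    -- the side condition of Case 8.1 for the gate of maximal out-degree
    have hside : ∀ {aQ : Fin 2} {Q Q' : Fin C.m}, C.arg G aQ = .gate Q → C.arg G aQ.rev = .gate Q' → Q' ∈ C.xorPart →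
        1 ≤ C.fanout (.gate Q) → 1 ≤ C.fanout (.gate Q') → C.fanout (.gate Q') ≤ C.fanout (.gate Q) →
        (2 ≤ C.fanout (.gate Q) ∨ (∃ t, C.arg G aQ.rev = .var t) ∨
          ∃ Pg, C.arg G aQ.rev = .gate Pg ∧ Pg ∈ C.xorPart ∧ C.fanout (.gate Pg) = 1) := by
      intro aQ Q Q' _ hGQ' hQ'K h1 h1' hle
      by_cases h2Q : 2 ≤ C.fanout (.gate Q)
      · exact Or.inl h2Q
      · exact Or.inr (Or.inr ⟨Q', hGQ', hQ'K, by omega⟩)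
    rcases le_total (C.fanout (.gate Q1)) (C.fanout (.gate Q0)) with hle | hle
    · -- `Q = Q0`
      by_cases hdepQ : ∃ x, C.DependsOn hF Q0 x ∧ ¬ R.Protected x
      · exact h81 0 Q0 hQ0 hQ0K (hside hQ0 hrev0 hQ1K h1Q0 h1Q1 hle) hdepQ
      push Not at hdepQ
      by_cases heq : C.fanout (.gate Q1) = C.fanout (.gate Q0)
      · by_cases hdepQ' : ∃ x, C.DependsOn hF Q1 x ∧ ¬ R.Protected x
        · exact h81 1 Q1 hQ1 hQ1K (hside hQ1 hrev1 hQ0K h1Q1 h1Q0 heq.ge) hdepQ'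
        push Not at hdepQ'
        exact hcall 0 Q0 ⟨hand, hQ0, hQ0K, hdepQ, Or.inr ⟨Q1, hrev0, hQ1K, hle, fun _ => hdepQ'⟩⟩
      · exact hcall 0 Q0 ⟨hand, hQ0, hQ0K, hdepQ, Or.inr ⟨Q1, hrev0, hQ1K, hle, fun h => absurd h heq⟩⟩
    · -- `Q = Q1`
      by_cases hdepQ : ∃ x, C.DependsOn hF Q1 x ∧ ¬ R.Protected x
      · exact h81 1 Q1 hQ1 hQ1K (hside hQ1 hrev1 hQ0K h1Q1 h1Q0 hle) hdepQ
      push Not at hdepQ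
      by_cases heq : C.fanout (.gate Q0) = C.fanout (.gate Q1)
      · by_cases hdepQ' : ∃ x, C.DependsOn hF Q0 x ∧ ¬ R.Protected x
        · exact h81 0 Q0 hQ0 hQ0K (hside hQ0 hrev0 hQ1K h1Q0 h1Q1 heq.ge) hdepQ'
        push Not at hdepQ'
        exact hcall 1 Q1 ⟨hand, hQ1, hQ1K, hdepQ, Or.inr ⟨Q0, hrev1, hQ0K, hle, fun _ => hdepQ'⟩⟩
      · exact hcall 1 Q1 ⟨hand, hQ1, hQ1K, hdepQ, Or.inr ⟨Q0, hrev1, hQ0K, hle, fun h => absurd h heq⟩⟩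

end Literature.Computability.Complexity
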